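import Literature.NumberTheory.Rogawski1990.RankOneUnstableTransferNonsplitCMOfCore     -- ★ p843033 A-p19 (g22): the (G4) engine `rankOneUnstableTransfer_letter_at_of_core` + inert closer shape
import HarnessLib

/-!
# (R-5a) THE RAMIFIED CLOSER SIBLING of (G4): `RankOneUnstableTransferNonsplitCMERamified` ⟸ (R1-core) at every RAMIFIED non-split place — and the residue-free
# closer `RankOneUnstableTransferNonsplitCME` ⟸ (R1-core inert) ∧ (R1-core ramified)  (road «R1-ram»; Rogawski 1990 Lemma 4.9.3 ∕ Labesse–Langlands §2)

Topic `NumberTheory/Rogawski1990`; namespace `Literature.NumberTheory.Rogawski1990`.  THEOREMS ONLY (no definition, no instance, no notation, no named fact, no `sorry`);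
no new mathematics — a by-import assembly over ★ p843033.  Cell `pub/hodgecm-mathlib` (D-0151), crux H413 = `stmt-HodgeConjecture-24833`, line «N6nsGerm» stub
`stub_N6nsR1LL`; LEAD F0P3a-plan (g10) WORD T9-8 (A) ∕ T9-10; architect A-p16 (g27) RULINGS A-14 (c) (ramified road of record = F0P3-p02 (g12) MEMO-R1ram §4, R-0…R-5) and
A-15 (b) (R-5a → F0P3a-p08 (g14)).  HONEST LABEL: HC_CM is proved only modulo the printed citations (the 2 remaining named inputs hLiu418, h413) until rung 0 closes; this
file is hypothesis-driven on the ramified core `hcore_ram` (bricks R-1…R-4, R-5b) exactly as ★ p843033 is on the inert core.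

THE SHAPE.  ★ `rankOneUnstableTransfer_letter_at_of_core (hv)` — A-p19's pointwise engine — carries NO unramifiedness hypothesis (MEMO-R1ram §1): at one
`(L, v, ν, m, Reg, f, t₀, P, d)` it turns the measure-family-free core statement `∃ fC locally constant, Δ(t)·(O_ν(t, f) − O_ν(t′, f)) = fC t` (regular `t ∈ Z(t₀)`, `t′` the
other class of the stable pair) into the letter's conclusion.  Hence the residue ★ `RankOneUnstableTransferNonsplitCMERamified` (ED. 4 :319: the letter restricted to
`¬ Algebra.IsUnramifiedIn (𝓞 L) v`) follows from the ramified core `hcore_ram` — the binder of ★ `rankOneUnstableTransferNonsplitCME_of_core_of_ramified`'s `hcore` TOKEN FOR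
TOKEN with `Algebra.IsUnramifiedIn (𝓞 L) v.asIdeal →` replaced by its negation; application order of record `L v hv hram μ ν hμu hμω f hf t₀ P d ht₀ hP hd1`.  At a ramified
`v` the unit row of the core is `0` (F0P3-p02 MEMO R-1, B-p12 (g29) census 758afe5c (N1)) but a general `f` is not, so `∃ fC` is kept.

* **`rankOneUnstableTransferNonsplitCMERamified_of_core`** `(hcore_ram) : RankOneUnstableTransferNonsplitCMERamified` — the R-5a closer.
* **`rankOneUnstableTransferNonsplitCME_of_core_of_core`** `(hcore) (hcore_ram) : RankOneUnstableTransferNonsplitCME` — the books' end state once both roads close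
  («R1LL-tree» inert ⊕ «R1-ram»): no named residue left (★ A-p19's closer ∘ the first theorem).

## References
* [Rogawski1990] J. D. Rogawski, *Automorphic Representations of Unitary Groups in Three Variables*, Ann. of Math. Stud. 123 (1990): §4.9 Lemma 4.9.3, (4.9.2) p. 56.
* [LabesseLanglands1979] J.-P. Labesse, R. P. Langlands, *L-indistinguishability for SL(2)*, Canad. J. Math. 31 (1979): §2.
-/

set_option autoImplicit false

noncomputable section

open Set Filter Topology MeasureTheory NumberField IsDedekindDomain Polynomial
open scoped Matrix MatrixGroups

namespace Literature.NumberTheory.Rogawski1990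

open Literature.NumberTheory.Automorphic Literature.NumberTheory.Automorphic.UnitaryGroup Literature.NumberTheory.GaloisRepresentations

/-- **(R-5a) THE RAMIFIED CLOSER: `RankOneUnstableTransferNonsplitCMERamified` ⟸ (R1-core) at the RAMIFIED non-split places.**  `hcore_ram` = A-p19's `hcore` binder with
`¬ Algebra.IsUnramifiedIn` (order `L v hv hram μ ν hμu hμω f hf t₀ P d ht₀ hP hd1`); the body is the pointwise engine ★ `rankOneUnstableTransfer_letter_at_of_core`, which is
ramification-blind. [cite: Rogawski1990, §4.9 Lemma 4.9.3 (4.9.2) p. 56] [cite: LabesseLanglands1979, §2] -/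
theorem rankOneUnstableTransferNonsplitCMERamified_of_core
    (hcore_ram : ∀ (L : Type) [Field L] [NumberField L] [IsCMField L] (v : HeightOneSpectrum (𝓞 ↥(maximalRealSubfield L))),
      Subsingleton (PlacesOver L v) → ¬ Algebra.IsUnramifiedIn (𝓞 L) v.asIdeal →
      ∀ (μ : HeckeCharacter L) [MeasurableSpace ((cmDatum L 2 (Matrix.of fun i j : Fin 2 => if i.val + j.val + 1 = 2 then (1 : L) else 0)).Local v × (cmDatum L 1 (Matrix.of fun i j : Fin 1 => if i.val + j.val + 1 = 1 then (1 : L) else 0)).Local v)] [BorelSpace ((cmDatum L 2 (Matrix.of fun i j : Fin 2 => if i.val + j.val + 1 = 2 then (1 : L) else 0)).Local v × (cmDatum L 1 (Matrix.of fun i j : Fin 1 => if i.val + j.val + 1 = 1 then (1 : L) else 0)).Local v)] (ν : Measure ((cmDatum L 2 (Matrix.of fun i j : Fin 2 => if i.val + j.val + 1 = 2 then (1 : L) else 0)).Local v × (cmDatum L 1 (Matrix.of fun i j : Fin 1 => if i.val + j.val + 1 = 1 then (1 : L) else 0)).Local v)) [ν.IsHaarMeasure] [ν.IsMulRightInvar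iant],
      μ.IsUnitary →
      (∀ x : ideleGroup ↥(maximalRealSubfield L), μ (AdeleRing.ideleBaseChange (↥(maximalRealSubfield L)) L x) = quadraticHeckeCharCM L x) →
      ∀ f : ((cmDatum L 2 (Matrix.of fun i j : Fin 2 => if i.val + j.val + 1 = 2 then (1 : L) else 0)).Local v × (cmDatum L 1 (Matrix.of fun i j : Fin 1 => if i.val + j.val + 1 = 1 then (1 : L) else 0)).Local v) → ℂ, IsLocSmooth f →
      ∀ (t₀ : ((cmDatum L 2 (Matrix.of fun i j : Fin 2 => if i.val + j.val + 1 = 2 then (1 : L) else 0)).Local v × (cmDatum L 1 (Matrix.of fun i j : Fin 1 => if i.val + j.val + 1 = 1 then (1 : L) else 0)).Local v)) (P : GL (Fin 2) (LocalRing L v)) (d : Fin 2 → (LocalRing L v)),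
        IsRegularElt (t₀.1.val : GL (Fin 2) (LocalRing L v)) →
        (t₀.1.val.val : Matrix (Fin 2) (Fin 2) (LocalRing L v)) * P.val = P.val * Matrix.diagonal d →
        (∀ i, conjLocal L (IsCMField.complexConj L) v (d i) * d i = 1) →
      ∃ fC : ↥(Subgroup.centralizer ({t₀} : Set ((cmDatum L 2 (Matrix.of fun i j : Fin 2 => if i.val + j.val + 1 = 2 then (1 : L) else 0)).Local v × (cmDatum L 1 (Matrix.of fun i j : Fin 1 => if i.val + j.val + 1 = 1 then (1 : L) else 0)).Local v))) → ℂ, IsLocallyConstant fC ∧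
        ∀ t : ↥(Subgroup.centralizer ({t₀} : Set ((cmDatum L 2 (Matrix.of fun i j : Fin 2 => if i.val + j.val + 1 = 2 then (1 : L) else 0)).Local v × (cmDatum L 1 (Matrix.of fun i j : Fin 1 => if i.val + j.val + 1 = 1 then (1 : L) else 0)).Local v))), IsRegularElt ((t : ((cmDatum L 2 (Matrix.of fun i j : Fin 2 => if i.val + j.val + 1 = 2 then (1 : L) else 0)).Local v × (cmDatum L 1 (Matrix.of fun i j : Fin 1 => if i.val + j.val + 1 = 1 then (1 : L) else 0)).Local v)).1.val : GL (Fin 2) (LocalRing L v)) → ∀ t' : ((cmDatum L 2 (Matrix.of fun i j : Fin 2 => if i.val + j.val + 1 = 2 then (1 : L) else 0)).Local v × (cmDatum L 1 (Matrix.of fun i j : Fin 1 => if i.val + j.val + 1 = 1 then (1 : L) else 0)).Local v),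
          IsLocalStablyConjH L v (t : ((cmDatum L 2 (Matrix.of fun i j : Fin 2 => if i.val + j.val + 1 = 2 then (1 : L) else 0)).Local v × (cmDatum L 1 (Matrix.of fun i j : Fin 1 => if i.val + j.val + 1 = 1 then (1 : L) else 0)).Local v)) t' → ¬ IsConj (t : ((cmDatum L 2 (Matrix.of fun i j : Fin 2 => if i.val + j.val + 1 = 2 then (1 : L) else 0)).Local v × (cmDatum L 1 (Matrix.of fun i j : Fin 1 => if i.val + j.val + 1 = 1 then (1 : L) else 0)).Local v)) t' →
          ((finHeckeValue L v μ (((P⁻¹).val * ((t : ((cmDatum L 2 (Matrix.of fun i j : Fin 2 => if i.val + j.val + 1 = 2 then (1 : L) else 0)).Local v × (cmDatum L 1 (Matrix.of fun i j : Fin 1 => if i.val + j.val + 1 = 1 then (1 : L) else 0)).Local v)).1.val.val : Matrix (Fin 2) (Fin 2) (LocalRing L v)) * P.val) 0 0 - ((P⁻¹).val * ((t : ((cmDatum L 2 (Matrix.of fun i j : Fin 2 => if i.val + j.val + 1 = 2 then (1 : L) else 0)).Local v × (cmDatum L 1 (Matrix.of fun i j : Fin 1 => if i.val + j.val + 1 =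 1 then (1 : L) else 0)).Local v)).1.val.val : Matrix (Fin 2) (Fin 2) (LocalRing L v)) * P.val) 1 1))⁻¹ : ℂ) *
              ((Real.sqrt (∏ w' : PlacesOver L v, ‖(((P⁻¹).val * ((t : ((cmDatum L 2 (Matrix.of fun i j : Fin 2 => if i.val + j.val + 1 = 2 then (1 : L) else 0)).Local v × (cmDatum L 1 (Matrix.of fun i j : Fin 1 => if i.val + j.val + 1 = 1 then (1 : L) else 0)).Local v)).1.val.val : Matrix (Fin 2) (Fin 2) (LocalRing L v)) * P.val) 0 0 - ((P⁻¹).val * ((t : ((cmDatum L 2 (Matrix.of fun i j : Fin 2 => if i.val + j.val + 1 = 2 then (1 : L) else 0)).Local v × (cmDatum L 1 (Matrix.of fun i j : Fin 1 => if i.val + j.val + 1 = 1 then (1 : L) else 0)).Local v)).1.val.val : Matrix (Fin 2) (Fin 2) (LocalRing L v)) * P.val) 1 1) w'‖) : ℝ) : ℂ) * ((∫ y, f (y * (t : ((cmDatum L 2 (Matrix.of fun i j : Fin 2 => if i.val + j.val + 1 = 2 then (1 : L) else 0)).Local v × (cmDatum L 1 (Matrix.of fun i j : Fin 1 => if i.val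 + j.val + 1 = 1 then (1 : L) else 0)).Local v)) * y⁻¹) ∂ν) - ∫ y, f (y * t' * y⁻¹) ∂ν) = fC t) :
    RankOneUnstableTransferNonsplitCMERamified := by
  intro L _ _ _ v hv hram μ _ _ ν _ _ _iZ _bZ m hμu hμω Reg hReg hconj hstab hm f hf t₀ P d ht₀ hP hd1
  exact rankOneUnstableTransfer_letter_at_of_core L v hv μ ν m Reg hReg hconj hstab hm f hf t₀ P d ht₀ hP hd1
    (hcore_ram L v hv hram μ ν hμu hμω f hf t₀ P d ht₀ hP hd1)

/-- **THE RESIDUE-FREE CLOSER: `RankOneUnstableTransferNonsplitCME` ⟸ (R1-core inert) ∧ (R1-core ramified)** — ★ `rankOneUnstableTransferNonsplitCME_of_core_of_ramified`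
fed with the R-5a closer; the books' end state for #159 (R1-CM) once the roads «R1LL-tree» and «R1-ram» both close.
[cite: Rogawski1990, §4.9 Lemma 4.9.3 (4.9.2) p. 56] [cite: LabesseLanglands1979, §2] -/
theorem rankOneUnstableTransferNonsplitCME_of_core_of_core
    (hcore : ∀ (L : Type) [Field L] [NumberField L] [IsCMField L] (v : HeightOneSpectrum (𝓞 ↥(maximalRealSubfield L))),
      Subsingleton (PlacesOver L v) → Algebra.IsUnramifiedIn (𝓞 L) v.asIdeal →
      ∀ (μ : HeckeCharacter L) [MeasurableSpace ((cmDatum L 2 (Matrix.of fun i j : Fin 2 => if i.val + j.val + 1 = 2 then (1 : L) else 0)).Local v × (cmDatum L 1 (Matrix.of fun i j : Fin 1 => if i.val + j.val + 1 = 1 then (1 : L) else 0)).Local v)] [BorelSpace ((cmDatum L 2 (Matrix.of fun i j : Fin 2 => if i.val + j.val + 1 = 2 then (1 : L) else 0)).Local v × (cmDatum L 1 (Matrix.of fun i j : Fin 1 => if i.val + j.val + 1 = 1 then (1 : L) else 0)).Local v)] (ν : Measure ((cmDatum L 2 (Matrix.of fun i j : Fin 2 => if i.val + j.val + 1 = 2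 then (1 : L) else 0)).Local v × (cmDatum L 1 (Matrix.of fun i j : Fin 1 => if i.val + j.val + 1 = 1 then (1 : L) else 0)).Local v)) [ν.IsHaarMeasure] [ν.IsMulRightInvariant],
      μ.IsUnitary →
      (∀ x : ideleGroup ↥(maximalRealSubfield L), μ (AdeleRing.ideleBaseChange (↥(maximalRealSubfield L)) L x) = quadraticHeckeCharCM L x) →
      ∀ f : ((cmDatum L 2 (Matrix.of fun i j : Fin 2 => if i.val + j.val + 1 = 2 then (1 : L) else 0)).Local v × (cmDatum L 1 (Matrix.of fun i j : Fin 1 => if i.val + j.val + 1 = 1 then (1 : L) else 0)).Local v) → ℂ, IsLocSmooth f →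
      ∀ (t₀ : ((cmDatum L 2 (Matrix.of fun i j : Fin 2 => if i.val + j.val + 1 = 2 then (1 : L) else 0)).Local v × (cmDatum L 1 (Matrix.of fun i j : Fin 1 => if i.val + j.val + 1 = 1 then (1 : L) else 0)).Local v)) (P : GL (Fin 2) (LocalRing L v)) (d : Fin 2 → (LocalRing L v)),
        IsRegularElt (t₀.1.val : GL (Fin 2) (LocalRing L v)) →
        (t₀.1.val.val : Matrix (Fin 2) (Fin 2) (LocalRing L v)) * P.val = P.val * Matrix.diagonal d →
        (∀ i, conjLocal L (IsCMField.complexConj L) v (d i) * d i = 1) →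
      ∃ fC : ↥(Subgroup.centralizer ({t₀} : Set ((cmDatum L 2 (Matrix.of fun i j : Fin 2 => if i.val + j.val + 1 = 2 then (1 : L) else 0)).Local v × (cmDatum L 1 (Matrix.of fun i j : Fin 1 => if i.val + j.val + 1 = 1 then (1 : L) else 0)).Local v))) → ℂ, IsLocallyConstant fC ∧
        ∀ t : ↥(Subgroup.centralizer ({t₀} : Set ((cmDatum L 2 (Matrix.of fun i j : Fin 2 => if i.val + j.val + 1 = 2 then (1 : L) else 0)).Local v × (cmDatum L 1 (Matrix.of fun i j : Fin 1 => if i.val + j.val + 1 = 1 then (1 : L) else 0)).Local v))), IsRegularElt ((t : ((cmDatum L 2 (Matrix.of fun i j : Fin 2 => if i.val + j.val + 1 = 2 then (1 : L) else 0)).Local v × (cmDatum L 1 (Matrix.of fun i j : Fin 1 => if i.val + j.val + 1 = 1 then (1 : L) else 0)).Local v)).1.val : GL (Fin 2) (LocalRing L v)) → ∀ t' : ((cmDatum L 2 (Matrix.of fun i j : Fin 2 => if i.val + j.val + 1 = 2 then (1 : L) else 0)).Local v × (cmDatum L 1 (Matrix.of fun i j : Fin 1 => if i.val + j.val + 1 =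 1 then (1 : L) else 0)).Local v),
          IsLocalStablyConjH L v (t : ((cmDatum L 2 (Matrix.of fun i j : Fin 2 => if i.val + j.val + 1 = 2 then (1 : L) else 0)).Local v × (cmDatum L 1 (Matrix.of fun i j : Fin 1 => if i.val + j.val + 1 = 1 then (1 : L) else 0)).Local v)) t' → ¬ IsConj (t : ((cmDatum L 2 (Matrix.of fun i j : Fin 2 => if i.val + j.val + 1 = 2 then (1 : L) else 0)).Local v × (cmDatum L 1 (Matrix.of fun i j : Fin 1 => if i.val + j.val + 1 = 1 then (1 : L) else 0)).Local v)) t' →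
          ((finHeckeValue L v μ (((P⁻¹).val * ((t : ((cmDatum L 2 (Matrix.of fun i j : Fin 2 => if i.val + j.val + 1 = 2 then (1 : L) else 0)).Local v × (cmDatum L 1 (Matrix.of fun i j : Fin 1 => if i.val + j.val + 1 = 1 then (1 : L) else 0)).Local v)).1.val.val : Matrix (Fin 2) (Fin 2) (LocalRing L v)) * P.val) 0 0 - ((P⁻¹).val * ((t : ((cmDatum L 2 (Matrix.of fun i j : Fin 2 => if i.val + j.val + 1 = 2 then (1 : L) else 0)).Local v × (cmDatum L 1 (Matrix.of fun i j : Fin 1 => if i.val + j.val + 1 = 1 then (1 : L) else 0)).Local v)).1.val.val : Matrix (Fin 2) (Fin 2) (LocalRing L v)) * P.val) 1 1))⁻¹ : ℂ) *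
              ((Real.sqrt (∏ w' : PlacesOver L v, ‖(((P⁻¹).val * ((t : ((cmDatum L 2 (Matrix.of fun i j : Fin 2 => if i.val + j.val + 1 = 2 then (1 : L) else 0)).Local v × (cmDatum L 1 (Matrix.of fun i j : Fin 1 => if i.val + j.val + 1 = 1 then (1 : L) else 0)).Local v)).1.val.val : Matrix (Fin 2) (Fin 2) (LocalRing L v)) * P.val) 0 0 - ((P⁻¹).val * ((t : ((cmDatum L 2 (Matrix.of fun i j : Fin 2 => if i.val + j.val + 1 = 2 then (1 : L) else 0)).Local v × (cmDatum L 1 (Matrix.of fun i j : Fin 1 => if i.val + j.val + 1 = 1 then (1 : L) else 0)).Local v)).1.val.val : Matrix (Fin 2) (Fin 2) (LocalRing L v)) * P.val) 1 1) w'‖) : ℝ) : ℂ) * ((∫ y, f (y * (t : ((cmDatum L 2 (Matrix.of fun i j : Fin 2 => if i.val + j.val + 1 = 2 then (1 : L) else 0)).Local v × (cmDatum L 1 (Matrix.of fun i j : Fin 1 => if i.val + j.val + 1 = 1 then (1 : L) else 0)).Local v)) * y⁻¹) ∂ν) - ∫ y, f (y * t' * y⁻¹) ∂ν) = fC t)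
    (hcore_ram : ∀ (L : Type) [Field L] [NumberField L] [IsCMField L] (v : HeightOneSpectrum (𝓞 ↥(maximalRealSubfield L))),
      Subsingleton (PlacesOver L v) → ¬ Algebra.IsUnramifiedIn (𝓞 L) v.asIdeal →
      ∀ (μ : HeckeCharacter L) [MeasurableSpace ((cmDatum L 2 (Matrix.of fun i j : Fin 2 => if i.val + j.val + 1 = 2 then (1 : L) else 0)).Local v × (cmDatum L 1 (Matrix.of fun i j : Fin 1 => if i.val + j.val + 1 = 1 then (1 : L) else 0)).Local v)] [BorelSpace ((cmDatum L 2 (Matrix.of fun i j : Fin 2 => if i.val + j.val + 1 = 2 then (1 : L) else 0)).Local v × (cmDatum L 1 (Matrix.of fun i j : Fin 1 => if i.val + j.val + 1 = 1 then (1 : L) else 0)).Local v)] (ν : Measure ((cmDatum L 2 (Matrix.of fun i j : Fin 2 => if i.val + j.val + 1 = 2 then (1 : L) else 0)).Local v × (cmDatum L 1 (Matrix.of fun i j : Fin 1 => if i.val + j.val + 1 = 1 then (1 : L) else 0)).Local v)) [ν.IsHaarMeasure] [ν.IsMulRightInvariant],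
      μ.IsUnitary →
      (∀ x : ideleGroup ↥(maximalRealSubfield L), μ (AdeleRing.ideleBaseChange (↥(maximalRealSubfield L)) L x) = quadraticHeckeCharCM L x) →
      ∀ f : ((cmDatum L 2 (Matrix.of fun i j : Fin 2 => if i.val + j.val + 1 = 2 then (1 : L) else 0)).Local v × (cmDatum L 1 (Matrix.of fun i j : Fin 1 => if i.val + j.val + 1 = 1 then (1 : L) else 0)).Local v) → ℂ, IsLocSmooth f →
      ∀ (t₀ : ((cmDatum L 2 (Matrix.of fun i j : Fin 2 => if i.val + j.val + 1 = 2 then (1 : L) else 0)).Local v × (cmDatum L 1 (Matrix.of fun i j : Fin 1 => if i.val + j.val + 1 = 1 then (1 : L) else 0)).Local v)) (P : GL (Fin 2) (LocalRing L v)) (d : Fin 2 → (LocalRing L v)),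
        IsRegularElt (t₀.1.val : GL (Fin 2) (LocalRing L v)) →
        (t₀.1.val.val : Matrix (Fin 2) (Fin 2) (LocalRing L v)) * P.val = P.val * Matrix.diagonal d →
        (∀ i, conjLocal L (IsCMField.complexConj L) v (d i) * d i = 1) →
      ∃ fC : ↥(Subgroup.centralizer ({t₀} : Set ((cmDatum L 2 (Matrix.of fun i j : Fin 2 => if i.val + j.val + 1 = 2 then (1 : L) else 0)).Local v × (cmDatum L 1 (Matrix.of fun i j : Fin 1 => if i.val + j.val + 1 = 1 then (1 : L) else 0)).Local v))) → ℂ, IsLocallyConstant fC ∧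
        ∀ t : ↥(Subgroup.centralizer ({t₀} : Set ((cmDatum L 2 (Matrix.of fun i j : Fin 2 => if i.val + j.val + 1 = 2 then (1 : L) else 0)).Local v × (cmDatum L 1 (Matrix.of fun i j : Fin 1 => if i.val + j.val + 1 = 1 then (1 : L) else 0)).Local v))), IsRegularElt ((t : ((cmDatum L 2 (Matrix.of fun i j : Fin 2 => if i.val + j.val + 1 = 2 then (1 : L) else 0)).Local v × (cmDatum L 1 (Matrix.of fun i j : Fin 1 => if i.val + j.val + 1 = 1 then (1 : L) else 0)).Local v)).1.val : GL (Fin 2) (LocalRing L v)) → ∀ t' : ((cmDatum L 2 (Matrix.of fun i j : Fin 2 => if i.val + j.val + 1 = 2 then (1 : L) else 0)).Local v × (cmDatum L 1 (Matrix.of fun i j : Fin 1 => if i.val + j.val + 1 = 1 then (1 : L) else 0)).Local v),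
          IsLocalStablyConjH L v (t : ((cmDatum L 2 (Matrix.of fun i j : Fin 2 => if i.val + j.val + 1 = 2 then (1 : L) else 0)).Local v × (cmDatum L 1 (Matrix.of fun i j : Fin 1 => if i.val + j.val + 1 = 1 then (1 : L) else 0)).Local v)) t' → ¬ IsConj (t : ((cmDatum L 2 (Matrix.of fun i j : Fin 2 => if i.val + j.val + 1 = 2 then (1 : L) else 0)).Local v × (cmDatum L 1 (Matrix.of fun i j : Fin 1 => if i.val + j.val + 1 = 1 then (1 : L) else 0)).Local v)) t' →
          ((finHeckeValue L v μ (((P⁻¹).val * ((t : ((cmDatum L 2 (Matrix.of fun i j : Fin 2 => if i.val + j.val + 1 = 2 then (1 : L) else 0)).Local v × (cmDatum L 1 (Matrix.of fun i j : Fin 1 => if i.val + j.val + 1 = 1 then (1 : L) else 0)).Local v)).1.val.val : Matrix (Fin 2) (Fin 2) (LocalRing L v)) * P.val) 0 0 - ((P⁻¹).val * ((t : ((cmDatum L 2 (Matrix.of fun i j : Fin 2 => if i.val + j.val + 1 = 2 then (1 : L) else 0)).Local v × (cmDatum L 1 (Matrix.of fun i j : Fin 1 => if i.val + j.val + 1 =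 1 then (1 : L) else 0)).Local v)).1.val.val : Matrix (Fin 2) (Fin 2) (LocalRing L v)) * P.val) 1 1))⁻¹ : ℂ) *
              ((Real.sqrt (∏ w' : PlacesOver L v, ‖(((P⁻¹).val * ((t : ((cmDatum L 2 (Matrix.of fun i j : Fin 2 => if i.val + j.val + 1 = 2 then (1 : L) else 0)).Local v × (cmDatum L 1 (Matrix.of fun i j : Fin 1 => if i.val + j.val + 1 = 1 then (1 : L) else 0)).Local v)).1.val.val : Matrix (Fin 2) (Fin 2) (LocalRing L v)) * P.val) 0 0 - ((P⁻¹).val * ((t : ((cmDatum L 2 (Matrix.of fun i j : Fin 2 => if i.val + j.val + 1 = 2 then (1 : L) else 0)).Local v × (cmDatum L 1 (Matrix.of fun i j : Fin 1 => if i.val + j.val + 1 = 1 then (1 : L) else 0)).Local v)).1.val.val : Matrix (Fin 2) (Fin 2) (LocalRing L v)) * P.val) 1 1) w'‖) : ℝ) : ℂ) * ((∫ y, f (y * (t : ((cmDatum L 2 (Matrix.of fun i j : Fin 2 => if i.val + j.val + 1 = 2 then (1 : L) else 0)).Local v × (cmDatum L 1 (Matrix.of fun i j : Fin 1 => if i.val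 + j.val + 1 = 1 then (1 : L) else 0)).Local v)) * y⁻¹) ∂ν) - ∫ y, f (y * t' * y⁻¹) ∂ν) = fC t) :
    RankOneUnstableTransferNonsplitCME :=
  rankOneUnstableTransferNonsplitCME_of_core_of_ramified hcore (rankOneUnstableTransferNonsplitCMERamified_of_core hcore_ram)

end Literature.NumberTheory.Rogawski1990

end
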